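import Summits.Ventures.PercRepro.Coupling
import Summits.Ventures.PercRepro.Nested

/-!
# Conjecture N implies the monotone polarisation of C-005

`conjectures/C-005.md` §Addendum 4 (lead): Conjecture N (typer-2's `ConjectureN`: `N(c, c') ≥ 0`
for every nested pair `c ≤ c'` of monotone maps from a cube with a product measure into the
partitions of four indices) specialises, through the standard monotone coupling
(`Coupling.lean`), to the **monotone polarisation** of C-005 on graphs: for weight vectors
`s ≤ t`,

  `Q(λ_s, λ_t) = T_t B_s + T_s B_t − Σ_{i≠j} x_i^t x_j^s ≥ 0`,

where `T, B, x_i` are the engine rows `0000`, `0123`, `0011 / 0101 / 0110` of the marked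
partition of `a, b, c, d` (`polarForm`).  The diagonal `s = t` is twice the C-005 defect
(`polarForm_self`), so `polarForm_nonneg_of_conjectureN` contains `C005_of_ConjectureN`.

Proof: on `E ⊕ E` with weights `(t, s/t)` the maps `ω ↦ Π(meetHalves ω)` and `ω ↦ Π(ω ∘ inl)` are
monotone, nested, and have the partition laws `λ_s` and `λ_t` (`prob_comp_meetHalves_ratio`,
`prob_comp_leftHalf`); `ConjectureN` applied to them is exactly `0 ≤ Q(λ_s, λ_t)`.
-/

namespace PercRepro

open Finset

namespace MultiGraph

variable {V : Type*} {E : Type} (G : MultiGraph V E)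

/-- The three crossing rows `0011`, `0101`, `0110` as restricted-growth strings. -/
def crossRows : Fin 3 → Fin 4 → ℕ := ![![0, 0, 1, 1], ![0, 1, 0, 1], ![0, 1, 1, 0]]


/-- The top row as a lattice fibre. -/
theorem setOf_markedPartition_eq_top (a b c d : V) :
    {ω : Config E | G.markedPartition ω ![a, b, c, d] = ⊤} =
      G.partitionEvent ![a, b, c, d] ![0, 0, 0, 0] := by
  rw [G.partitionEvent_eq_partitionSetoidEvent, Setoid.ker_rgs4_top]
  rfl

/-- The bottom row as a lattice fibre. -/
theorem setOf_markedPartition_eq_bot (a b c d : V) :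
    {ω : Config E | G.markedPartition ω ![a, b, c, d] = ⊥} =
      G.partitionEvent ![a, b, c, d] ![0, 1, 2, 3] := by
  rw [G.partitionEvent_eq_partitionSetoidEvent, Setoid.ker_rgs4_bot]
  rfl

/-- The crossing rows as lattice fibres. -/
theorem setOf_markedPartition_eq_cross4 (a b c d : V) (i : Fin 3) :
    {ω : Config E | G.markedPartition ω ![a, b, c, d] = cross4 i} =
      G.partitionEvent ![a, b, c, d] (crossRows i) := by
  rw [G.partitionEvent_eq_partitionSetoidEvent]
  fin_cases i <;> rfl

variable [Fintype E] [DecidableEq E]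

/-- **Monotone polarisation form** of C-005 for two weight vectors `s`, `t` (C-005.md Addendum 4):
`Q(λ_s, λ_t) = T_t B_s + T_s B_t − Σ_{i≠j} x_i^t x_j^s` in engine rows. -/
noncomputable def polarForm (s t : E → ℝ) (a b c d : V) : ℝ :=
  prob t (G.partitionEvent ![a, b, c, d] ![0, 0, 0, 0]) *
      prob s (G.partitionEvent ![a, b, c, d] ![0, 1, 2, 3]) +
    prob s (G.partitionEvent ![a, b, c, d] ![0, 0, 0, 0]) *
      prob t (G.partitionEvent ![a, b, c, d] ![0, 1, 2, 3]) -
    ∑ i : Fin 3, ∑ j : Fin 3,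
      if i ≠ j then prob t (G.partitionEvent ![a, b, c, d] (crossRows i)) *
        prob s (G.partitionEvent ![a, b, c, d] (crossRows j)) else 0

/-- **The nested form of the coupled partitions is the polarisation form**: under
`(t, ratioWeights s t)` on `E ⊕ E`, `N(Π ∘ meetHalves, Π ∘ (· ∘ inl)) = Q(λ_s, λ_t)`. -/
theorem nestedForm_coupling {s t : E → ℝ} (hs : IsProb s) (hst : s ≤ t) (a b c d : V) :
    nestedForm (Sum.elim t (ratioWeights s t))
        (fun ω => G.markedPartition (meetHalves ω) ![a, b, c, d])
        (fun ω => G.markedPartition (ω ∘ Sum.inl) ![a, b, c, d]) =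
      G.polarForm s t a b c d := by
  unfold nestedForm polarForm
  have hm : ∀ σ : Setoid (Fin 4),
      prob (Sum.elim t (ratioWeights s t))
          {ω : Config (E ⊕ E) | G.markedPartition (meetHalves ω) ![a, b, c, d] = σ} =
        prob s {ζ : Config E | G.markedPartition ζ ![a, b, c, d] = σ} :=
    fun σ => prob_comp_meetHalves_ratio hs hst (fun ζ => G.markedPartition ζ ![a, b, c, d]) σ
  have hl : ∀ σ : Setoid (Fin 4),
      prob (Sum.elim t (ratioWeights s t))
          {ω : Config (E ⊕ E) | G.markedPartition (ω ∘ Sum.inl) ![a, b, c, d] = σ} =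
        prob t {ζ : Config E | G.markedPartition ζ ![a, b, c, d] = σ} :=
    fun σ => prob_comp_leftHalf t (ratioWeights s t) (fun ζ => G.markedPartition ζ ![a, b, c, d]) σ
  simp only [hm, hl, G.setOf_markedPartition_eq_top, G.setOf_markedPartition_eq_bot,
    G.setOf_markedPartition_eq_cross4]

/-- **Conjecture N implies the monotone polarisation of C-005**: for `s ≤ t`,
`T_t B_s + T_s B_t ≥ Σ_{i≠j} x_i^t x_j^s`. -/
theorem polarForm_nonneg_of_conjectureN (hN : ConjectureN) {s t : E → ℝ} (hs : IsProb s)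
    (ht : IsProb t) (hst : s ≤ t) (a b c d : V) : 0 ≤ G.polarForm s t a b c d := by
  rw [← G.nestedForm_coupling hs hst]
  exact hN (Sum.elim t (ratioWeights s t)) (isProb_sum_elim ht (isProb_ratioWeights hs ht hst))
    _ _ (monotone_comp_meetHalves (G.markedPartition_mono _))
    (monotone_comp_leftHalf (G.markedPartition_mono _))
    (fun ω => comp_meetHalves_le_comp_leftHalf (G.markedPartition_mono _) ω)

/-- On the diagonal `s = t` the polarisation form is twice the C-005 defect. -/
theorem polarForm_self (p : E → ℝ) (a b c d : V) :
    G.polarForm p p a b c d =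
      2 * (prob p (G.partitionEvent ![a, b, c, d] ![0, 0, 0, 0]) *
            prob p (G.partitionEvent ![a, b, c, d] ![0, 1, 2, 3]) -
          (prob p (G.partitionEvent ![a, b, c, d] ![0, 0, 1, 1]) *
              prob p (G.partitionEvent ![a, b, c, d] ![0, 1, 0, 1]) +
            prob p (G.partitionEvent ![a, b, c, d] ![0, 0, 1, 1]) *
              prob p (G.partitionEvent ![a, b, c, d] ![0, 1, 1, 0]) +
            prob p (G.partitionEvent ![a, b, c, d] ![0, 1, 0, 1]) *
              prob p (G.partitionEvent ![a, b, c, d] ![0, 1, 1, 0]))) := by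
  simp only [polarForm, crossRows, Fin.sum_univ_succ, Fin.sum_univ_zero]
  simp
  ring

end MultiGraph

end PercRepro
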